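import Mathlib
import HarnessLib

/-!
# The Bhanot–Kennedy unbiased stochastic estimator of an exponential

Topic `Probability/Moments`.  PUBLISHED RESULT with our formalisation (Mathlib probability:
independence, Bochner integral, summable series); every statement proved, no named fact.

Sources.
* G. Bhanot, A. D. Kennedy, *Bosonic lattice gauge theory with noise*, Phys. Lett. B 157 (1985)
  70–76 (the primary, not held; cited through the restatement below).
* L. Lin, K.-F. Liu, J. Sloan, *A noisy Monte Carlo algorithm*, Phys. Rev. D 61 (2000) 074505
  [hep-lat/9905033], READ: §I, eq. (3) and the paragraph after it — "it is demonstrated by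
  Bhanot and Kennedy [BK] that an unbiased estimator `⟨e^{ΔH}⟩` can be constructed via a series
  expansion of the exponential in terms of the powers of independent unbiased estimator `⟨ΔH⟩` …
  each `eˣ` is estimated by the series expansion developed by Bhanot and Kennedy [BK]:
  `⟨eˣ⟩ = 1 + x₁(1 + ½x₂(1 + ⅓x₃(1 + …)))` where the coefficients in the Taylor expansion are
  interpreted as probabilities.  The procedure goes as follows.  First, one sets `⟨eˣ⟩ = 1 + x₁`.
  Then one adds `x₁x₂` to `⟨eˣ⟩` with probability `½`; otherwise one stops.  If it is not
  stopped, one then continues to add `x₁x₂x₃` to `⟨eˣ⟩` with probability `⅓`, and so on.  It is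
  easy to prove [BK] that the above estimator is unbiased", with "`x₁, x₂, …` identical,
  independent unbiased estimators"; and §III eq. (17) (`e^{Tr ln M} = 1 + Tr ln M(1 +
  (Tr ln M)/2 (1 + (Tr ln M)/3 (…)))`, "calculated stochastically as a random walk process [BK]")
  with its integral form eq. (18) (independent noises `ηᵢ`, uniform `ρₙ`, continuation
  thresholds `θ(ρₙ − (n−1)/n)`; "This sequence terminates stochastically in finite time").

Lean reading.  On a probability space `(Ω, μ)`: the estimates are real random variables
`x : ℕ → Ω → ℝ` (the `i`-th factor of the `n`-th Taylor term is `x i`, `i < n`), the random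
TRUNCATION LEVEL is `K : Ω → ℕ` — the index of the last term kept, so that "one sets
`⟨eˣ⟩ = 1 + x₁`" always (`K ≥ 1`), the term `x₁x₂` is kept with probability `½`, …, i.e. the
survival law `μ{n ≤ K} = 1/n!` (`survivalProb_eq_inv_factorial` records that continuing at step
`k` with probability `1/k` gives exactly this) — and the estimator is the random finite sum
`bkEst x K ω = Σ_{n ≤ K ω} Π_{i<n} xᵢ(ω)`.  Independence of the level and all the estimates is ONE
hypothesis: the family `o ↦ (K` for `o = none`, `xᵢ` for `o = some i)` is `iIndepFun`.

Contents (all proved).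
* `bkEst`, `bkTerm` (the `n`-th term with its survival indicator), `bkEst_eq_tsum`;
* `integral_bkTerm` — `E[1_{n ≤ K} Π_{i<n} xᵢ] = μ{n ≤ K} · Π_{i<n} E xᵢ` (independence), and
  `integral_abs_bkTerm` (the same with absolute values), `integrable_bkTerm`;
* **`integral_bkEst`** — UNBIASEDNESS: if every `xᵢ` has mean `a`, first absolute moments
  bounded by `b`, and `μ{n ≤ K} = 1/n!`, then `bkEst x K` is integrable and
  `E[bkEst x K] = eᵃ` ("the above estimator is unbiased"); the proof is the printed one — the
  `n`-th term has mean `aⁿ/n!` and the series is absolutely convergent in `L¹` (dominated by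
  `Σ bⁿ/n! = eᵇ`), so expectation and sum commute;
* `survivalProb_eq_inv_factorial` — `Π_{k<n} 1/(k+1) = 1/n!`.

* **Second moment and variance** (section `SecondMoment`, appended): `integral_bkTerm_mul`
  (`E[T_n T_m] = μ{m ≤ K} m₂ⁿ m₁^{m−n}`, `n ≤ m`), `bkEst_sq_eq_tsum` (`Y² = Σ_m T_m(T_m +
  2Σ_{n<m} T_n)`), **`hasSum_integral_bkEst_sq`** (`E Y² = Σ_m (1/m!)(m₂^m + 2Σ_{n<m} m₂ⁿ m₁^{m−n})`),
  **`integral_bkEst_sq_mul_sub`** / **`integral_bkEst_sq`** — Lin–Liu–Sloan eq. (4), one factor: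
  `E Y² = e^{m₂} + 2(e^{m₁} − e^{m₂}) m₁/(m₁ − m₂)` (`m₁ = E xᵢ`, `m₂ = E xᵢ²`), `variance_bkEst`,
  `integral_bkEst_sq_centred` / `variance_bkEst_centred` (`m₁ = 0`: `E Y² = e^{m₂}`, `Var = e^{m₂}
  − 1`), and for `N` independent factors `variance_prod` (`Var Π Y_j = s^N − e^{2Nm₁}` — eq. (4))
  and `variance_prod_centred` (`= e^{δ²/N} − 1`, §III).

Deliberate omissions.  (i) [typed in section `SecondMoment` below — this item is superseded].  (ii) No construction of `K` from
uniforms `ρₙ` (eq. (18)) — only its law enters.  (iii) The contrast statement "simple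
exponentiation `e^{⟨ΔH⟩}` inevitably yields a bias" is Jensen's inequality (in the tree:
`Summit.Ventures.LatticeQCDFlow.Exactness.jensen_exp`, a venture file; not imported here).

Context (cell pub-lqcd, HOME/R2-SCOPE.md §3 D3 / N2, §4 E7): this is the unbiased determinant
estimator `f(U, ξ)` that the Kentucky noisy Monte Carlo (route D3) requires; N2 is the biased
alternative it replaces.
-/

namespace Literature.Probability.Moments

open _root_.MeasureTheory _root_.ProbabilityTheory Finset
open scoped Nat

namespace BhanotKennedy

variable {Ω : Type*} [MeasurableSpace Ω] {μ : Measure Ω}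

/-! ## The estimator -/

/-- The BHANOT–KENNEDY randomized-Taylor estimator of `eˣ`: with estimates `xᵢ` and truncation
level `K`, `Σ_{n=0}^{K} Π_{i<n} xᵢ = 1 + x₀ + x₀x₁ + ⋯ + x₀⋯x_{K−1}`.
[cite: LinLiuSloan2000, §I eq. (3) and the procedure after it]; [cite: BhanotKennedy1985, main
construction] -/
def bkEst (x : ℕ → Ω → ℝ) (K : Ω → ℕ) (ω : Ω) : ℝ :=
  ∑ n ∈ Finset.range (K ω + 1), ∏ i ∈ Finset.range n, x i ω

/-- The `n`-th Taylor term with its survival indicator: `1_{n ≤ K} · Π_{i<n} xᵢ`.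
[cite: LinLiuSloan2000, §III eq. (18) (the factors `θ(ρₙ − (n−1)/n)`)] -/
def bkTerm (x : ℕ → Ω → ℝ) (K : Ω → ℕ) (n : ℕ) (ω : Ω) : ℝ :=
  (if n ≤ K ω then 1 else 0) * ∏ i ∈ Finset.range n, x i ω

omit [MeasurableSpace Ω] in
/-- The estimator is the (pointwise finite) series of its terms.
[cite: LinLiuSloan2000, §I eq. (3) / §III eq. (17)–(18)] -/
theorem bkEst_eq_tsum (x : ℕ → Ω → ℝ) (K : Ω → ℕ) (ω : Ω) :
    bkEst x K ω = ∑' n, bkTerm x K n ω := by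
  have h : ∀ n ∉ Finset.range (K ω + 1), bkTerm x K n ω = 0 := by
    intro n hn
    rw [Finset.mem_range, not_lt] at hn
    unfold bkTerm
    rw [if_neg (by omega), zero_mul]
  rw [tsum_eq_sum h]
  unfold bkEst bkTerm
  refine Finset.sum_congr rfl fun n hn => ?_
  rw [Finset.mem_range] at hn
  rw [if_pos (by omega), one_mul]

/-- "The coefficients in the Taylor expansion are interpreted as probabilities": continuing at
step `k+1` with probability `1/(k+1)` (`k = 1, …, n−1`; step `1` is always taken) keeps the
`n`-th term with probability `Π_{k<n} 1/(k+1) = 1/n!`. [cite: LinLiuSloan2000, §I, the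
procedure after eq. (3) ("with probability `½` … with probability `⅓`, and so on")] -/
theorem survivalProb_eq_inv_factorial (n : ℕ) :
    ∏ k ∈ Finset.range n, (1 / ((k : ℝ) + 1)) = 1 / (n ! : ℝ) := by
  rw [Finset.prod_div_distrib, Finset.prod_const_one, ← Finset.prod_range_add_one_eq_factorial]
  push_cast
  rfl

/-! ## The joint independent family (level and estimates) -/

/-- The family "truncation level and all estimates" indexed by `Option ℕ` (`none ↦ K` as a real
random variable, `some i ↦ xᵢ`), whose mutual independence is the hypothesis "independent
unbiased estimators" together with the independent stopping decisions.
[cite: LinLiuSloan2000, §III eq. (18) (independent `ηᵢ` and `ρₙ`)] -/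
def family (x : ℕ → Ω → ℝ) (K : Ω → ℕ) : Option ℕ → Ω → ℝ :=
  fun o => o.elim (fun ω => (K ω : ℝ)) x

omit [MeasurableSpace Ω] in
/-- The `none` component of the family is the level. [cite: LinLiuSloan2000, §III eq. (18)
(the stopping variables `ρₙ`)] -/
@[simp] theorem family_none (x : ℕ → Ω → ℝ) (K : Ω → ℕ) :
    family x K none = fun ω => (K ω : ℝ) := rfl

omit [MeasurableSpace Ω] in
/-- The `some i` component of the family is the `i`-th estimate. [cite: LinLiuSloan2000, §III
eq. (18) (the noises `ηᵢ`)] -/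
@[simp] theorem family_some (x : ℕ → Ω → ℝ) (K : Ω → ℕ) (i : ℕ) :
    family x K (some i) = x i := rfl

/-- A finite product of mutually independent integrable real random variables is integrable.
[cite: LinLiuSloan2000, §I (the products `x₁x₂⋯xₙ` of independent estimates have finite
means)] -/
theorem integrable_finset_prod_of_iIndepFun {ι : Type*} {Y : ι → Ω → ℝ} (hY : iIndepFun Y μ)
    (hm : ∀ i, Measurable (Y i)) (hi : ∀ i, Integrable (Y i) μ) (s : Finset ι) :
    Integrable (fun ω => ∏ i ∈ s, Y i ω) μ := by
  classical
  have := hY.isProbabilityMeasure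
  induction s using Finset.induction_on with
  | empty => simp
  | insert j s hj ih =>
    have hind : IndepFun (∏ i ∈ s, Y i) (Y j) μ := hY.indepFun_finsetProd_of_notMem hm hj
    have hs : Integrable (∏ i ∈ s, Y i) μ := by
      convert ih using 1
      ext ω
      simp [Finset.prod_apply]
    have h := hind.symm.integrable_mul (hi j) hs
    convert h using 1
    ext ω
    simp [Finset.prod_insert hj, Finset.prod_apply]

section Unbiased

variable {x : ℕ → Ω → ℝ} {K : Ω → ℕ}

/-- The restriction of the family to the level and the first `n` estimates, indexed by
`Option (Fin n)`. [cite: LinLiuSloan2000, §III eq. (18)] -/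
def familyFin (x : ℕ → Ω → ℝ) (K : Ω → ℕ) (n : ℕ) : Option (Fin n) → Ω → ℝ :=
  fun j => family x K (Option.map Fin.val j)

/-- Independence of the restricted family. [cite: LinLiuSloan2000, §III eq. (18)] -/
theorem iIndepFun_familyFin (hind : iIndepFun (family x K) μ) (n : ℕ) :
    iIndepFun (familyFin x K n) μ := by
  unfold familyFin
  exact hind.precomp (g := Option.map Fin.val) (Option.map_injective Fin.val_injective)

/-- The factor functions applied to the restricted family: the survival indicator on the level,
a given function `g` on each estimate. [cite: LinLiuSloan2000, §III eq. (18)] -/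
noncomputable def factorFun (n : ℕ) (g : ℝ → ℝ) : Option (Fin n) → ℝ → ℝ :=
  fun j => j.elim (fun r => if (n : ℝ) ≤ r then 1 else 0) (fun _ => g)

omit [MeasurableSpace Ω] in
/-- The product of the factors is `1_{n ≤ K} · Π_{i<n} g(xᵢ)`.
[cite: LinLiuSloan2000, §III eq. (18)] -/
theorem prod_factorFun_familyFin (n : ℕ) (g : ℝ → ℝ) (ω : Ω) :
    ∏ j, factorFun n g j (familyFin x K n j ω) =
      (if n ≤ K ω then 1 else 0) * ∏ i ∈ Finset.range n, g (x i ω) := by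
  rw [Fintype.prod_option]
  congr 1
  · simp [factorFun, familyFin, family]
  · simp only [factorFun, familyFin, family, Option.map_some, Option.elim_some]
    exact Fin.prod_univ_eq_prod_range (fun i => g (x i ω)) n

/-- The survival indicator is measurable in the level. [cite: LinLiuSloan2000, §III eq. (18)] -/
theorem measurable_indicatorFun (n : ℕ) :
    Measurable (fun r : ℝ => if (n : ℝ) ≤ r then (1 : ℝ) else 0) :=
  Measurable.ite measurableSet_Ici measurable_const measurable_const

/-- The level, read as a real random variable, is measurable. [cite: LinLiuSloan2000, §III
eq. (18)] -/
theorem measurable_level_real (hKm : Measurable K) : Measurable (fun ω => (K ω : ℝ)) :=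
  (measurable_from_nat (f := fun k : ℕ => (k : ℝ))).comp hKm

/-- `E[1_{n ≤ K}] = μ{n ≤ K}`. [cite: LinLiuSloan2000, §I (the probability of keeping the
`n`-th term)] -/
theorem integral_indicator_level (hKm : Measurable K) (n : ℕ) :
    ∫ ω, (if (n : ℝ) ≤ (K ω : ℝ) then (1 : ℝ) else 0) ∂μ = μ.real {ω | n ≤ K ω} := by
  have hset : MeasurableSet {ω | n ≤ K ω} := hKm measurableSet_Ici
  rw [← integral_indicator_one hset]
  refine integral_congr_ae (ae_of_all _ fun ω => ?_)
  simp only [Set.indicator_apply, Set.mem_setOf_eq, Nat.cast_le, Pi.one_apply]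

/-- **Mean of the `n`-th term** (independence): `E[1_{n≤K} Π_{i<n} g(xᵢ)] =
μ{n ≤ K} · Π_{i<n} E[g(xᵢ)]` for any measurable `g`.
[cite: LinLiuSloan2000, §I ("independent unbiased estimators"; the `n`-th term contributes
its coefficient times the product of the means)] -/
theorem integral_indicator_mul_prod (hind : iIndepFun (family x K) μ) (hKm : Measurable K)
    (hxm : ∀ i, Measurable (x i)) (n : ℕ) {g : ℝ → ℝ} (hg : Measurable g) :
    ∫ ω, (if n ≤ K ω then (1 : ℝ) else 0) * ∏ i ∈ Finset.range n, g (x i ω) ∂μ =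
      μ.real {ω | n ≤ K ω} * ∏ i ∈ Finset.range n, ∫ ω, g (x i ω) ∂μ := by
  have hW : iIndepFun (familyFin x K n) μ := iIndepFun_familyFin hind n
  have hWm : ∀ j, AEMeasurable (familyFin x K n j) μ := by
    intro j
    cases j with
    | none => exact (measurable_level_real hKm).aemeasurable
    | some i => exact (hxm i.val).aemeasurable
  have hf : ∀ j, AEStronglyMeasurable (factorFun n g j) (μ.map (familyFin x K n j)) := by
    intro j
    cases j with
    | none => exact (measurable_indicatorFun n).aestronglyMeasurable
    | some i => exact hg.aestronglyMeasurable
  have h := hW.integral_fun_prod_comp hWm hf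
  simp_rw [prod_factorFun_familyFin] at h
  rw [h, Fintype.prod_option]
  congr 1
  · simp only [factorFun, familyFin, family, Option.map_none, Option.elim_none]
    exact integral_indicator_level hKm n
  · simp only [factorFun, familyFin, family, Option.map_some, Option.elim_some]
    exact Fin.prod_univ_eq_prod_range (fun i => ∫ ω, g (x i ω) ∂μ) n

/-- **Mean of the `n`-th term**: `E[bkTerm n] = μ{n ≤ K} · Π_{i<n} E xᵢ`.
[cite: LinLiuSloan2000, §I (after eq. (3))] -/
theorem integral_bkTerm (hind : iIndepFun (family x K) μ) (hKm : Measurable K)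
    (hxm : ∀ i, Measurable (x i)) (n : ℕ) :
    ∫ ω, bkTerm x K n ω ∂μ = μ.real {ω | n ≤ K ω} * ∏ i ∈ Finset.range n, ∫ ω, x i ω ∂μ := by
  unfold bkTerm
  exact integral_indicator_mul_prod hind hKm hxm n measurable_id

/-- **First absolute moment of the `n`-th term**: `E|bkTerm n| = μ{n ≤ K} · Π_{i<n} E|xᵢ|`.
[cite: LinLiuSloan2000, §I (after eq. (3))] -/
theorem integral_abs_bkTerm (hind : iIndepFun (family x K) μ) (hKm : Measurable K)
    (hxm : ∀ i, Measurable (x i)) (n : ℕ) :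
    ∫ ω, |bkTerm x K n ω| ∂μ = μ.real {ω | n ≤ K ω} * ∏ i ∈ Finset.range n, ∫ ω, |x i ω| ∂μ := by
  have e : ∀ ω, |bkTerm x K n ω| = (if n ≤ K ω then (1 : ℝ) else 0) * ∏ i ∈ Finset.range n, |x i ω| := by
    intro ω
    unfold bkTerm
    rw [abs_mul, Finset.abs_prod]
    congr 1
    split_ifs <;> simp
  simp_rw [e]
  exact integral_indicator_mul_prod hind hKm hxm n measurable_id.abs

/-- Each term is integrable (a finite product of independent integrable factors).
[cite: LinLiuSloan2000, §I (after eq. (3))] -/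
theorem integrable_bkTerm (hind : iIndepFun (family x K) μ) (hKm : Measurable K)
    (hxm : ∀ i, Measurable (x i)) (hxi : ∀ i, Integrable (x i) μ) (n : ℕ) :
    Integrable (bkTerm x K n) μ := by
  have := hind.isProbabilityMeasure
  have hW : iIndepFun (familyFin x K n) μ := iIndepFun_familyFin hind n
  have hfm : ∀ j, Measurable (factorFun n id j) := by
    intro j
    cases j with
    | none => exact measurable_indicatorFun n
    | some i => exact measurable_id
  have hY : iIndepFun (fun j => factorFun n id j ∘ familyFin x K n j) μ := hW.comp _ hfm
  have hYm : ∀ j, Measurable (factorFun n id j ∘ familyFin x K n j) := by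
    intro j
    cases j with
    | none => exact (measurable_indicatorFun n).comp (measurable_level_real hKm)
    | some i => exact measurable_id.comp (hxm i.val)
  have hYi : ∀ j, Integrable (factorFun n id j ∘ familyFin x K n j) μ := by
    intro j
    cases j with
    | none =>
      refine Integrable.of_bound (C := 1) (hYm none).aestronglyMeasurable (ae_of_all _ fun ω => ?_)
      simp only [Function.comp_apply, factorFun, Option.elim_none, Real.norm_eq_abs]
      split_ifs <;> simp
    | some i => exact hxi i.val
  have h := integrable_finset_prod_of_iIndepFun hY hYm hYi Finset.univ
  refine h.congr (ae_of_all _ fun ω => ?_)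
  have := prod_factorFun_familyFin (x := x) (K := K) n id ω
  simp only [Function.comp_apply] at this ⊢
  rw [this]
  rfl

/-- **THE BHANOT–KENNEDY ESTIMATOR IS UNBIASED.**  If the estimates `xᵢ` are mutually
independent and independent of the truncation level `K`, every `xᵢ` has mean `a` and first
absolute moment at most `b`, and the level has the survival law `μ{n ≤ K} = 1/n!` ("the
coefficients in the Taylor expansion are interpreted as probabilities"), then the random finite
sum `Σ_{n ≤ K} Π_{i<n} xᵢ` is integrable and its mean is EXACTLY `eᵃ`:
`E[Σ_{n≤K} Π_{i<n} xᵢ] = Σₙ (1/n!) aⁿ = eᵃ` ("It is easy to prove [BK] that the above estimator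
is unbiased").  [cite: LinLiuSloan2000, §I eq. (3) and the paragraph after it; §III
eq. (17)–(18)]; [cite: BhanotKennedy1985, main result] -/
theorem integral_bkEst (hind : iIndepFun (family x K) μ) (hKm : Measurable K)
    (hxm : ∀ i, Measurable (x i)) (hxi : ∀ i, Integrable (x i) μ) {a b : ℝ}
    (hmean : ∀ i, ∫ ω, x i ω ∂μ = a) (habs : ∀ i, ∫ ω, |x i ω| ∂μ ≤ b)
    (hK : ∀ n : ℕ, μ.real {ω | n ≤ K ω} = 1 / (n ! : ℝ)) :
    Integrable (bkEst x K) μ ∧ ∫ ω, bkEst x K ω ∂μ = Real.exp a := by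
  have := hind.isProbabilityMeasure
  -- means of the terms
  have hterm : ∀ n, ∫ ω, bkTerm x K n ω ∂μ = a ^ n / n ! := by
    intro n
    rw [integral_bkTerm hind hKm hxm n, hK n, Finset.prod_congr rfl fun i _ => hmean i,
      Finset.prod_const, Finset.card_range]
    ring
  -- absolute first moments of the terms are dominated by `bⁿ/n!`
  have hb : 0 ≤ b := le_trans (integral_nonneg fun ω => abs_nonneg _) (habs 0)
  have hnorm : ∀ n, ∫ ω, ‖bkTerm x K n ω‖ ∂μ ≤ b ^ n / n ! := by
    intro n
    simp_rw [Real.norm_eq_abs]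
    rw [integral_abs_bkTerm hind hKm hxm n, hK n]
    have hP : ∏ i ∈ Finset.range n, ∫ ω, |x i ω| ∂μ ≤ b ^ n :=
      calc ∏ i ∈ Finset.range n, ∫ ω, |x i ω| ∂μ ≤ ∏ _i ∈ Finset.range n, b :=
            Finset.prod_le_prod (fun i _ => integral_nonneg fun ω => abs_nonneg _)
              (fun i _ => habs i)
        _ = b ^ n := by rw [Finset.prod_const, Finset.card_range]
    calc 1 / (n ! : ℝ) * ∏ i ∈ Finset.range n, ∫ ω, |x i ω| ∂μ ≤ 1 / (n ! : ℝ) * b ^ n :=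
          mul_le_mul_of_nonneg_left hP (by positivity)
      _ = b ^ n / n ! := by ring
  have hsum : Summable fun n => ∫ ω, ‖bkTerm x K n ω‖ ∂μ :=
    Summable.of_nonneg_of_le (fun n => integral_nonneg fun ω => norm_nonneg _) hnorm
      (Real.summable_pow_div_factorial b)
  -- exchange of expectation and series
  have hmain : ∫ ω, bkEst x K ω ∂μ = Real.exp a := by
    have e : (fun ω => bkEst x K ω) = fun ω => ∑' n, bkTerm x K n ω := funext (bkEst_eq_tsum x K)
    rw [e, ← integral_tsum_of_summable_integral_norm (integrable_bkTerm hind hKm hxm hxi) hsum]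
    simp_rw [hterm]
    rw [Real.exp_eq_exp_ℝ, NormedSpace.exp_eq_tsum_div]
  refine ⟨?_, hmain⟩
  by_contra h
  rw [integral_undef h] at hmain
  exact (Real.exp_pos a).ne hmain

end Unbiased


/-! ## The second moment and the variance (Lin–Liu–Sloan 2000, eq. (4))

Source, VERBATIM [LinLiuSloan2000, §I, after eq. (3)] (held text `paper:arxiv-hep-lat_9905033`
p0003:L99–L112, p0007:L104–L110): "It is easy to prove [BK] that the above estimator is unbiased.
One can also calculate its variance which is
`Var(⟨e^{ΔH}⟩) = {e^{(ΔH̄² + δ²)/N²} + 2(e^{ΔH̄/N} − e^{(ΔH̄² + δ²)/N²}) (ΔH̄/N)/(ΔH̄/N − (ΔH̄²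
+ δ²)/N²)}^N − e^{2ΔH̄}`  (4), where `δ² = \overline{ΔH²} − ΔH̄²` is the variance of `ΔH` from the
noise estimate" — for the product estimator (3) `⟨e^{ΔH}⟩ ≡ Π_{i=1}^N e^{x_i}` of `N` independent
randomized-Taylor estimators whose inputs are "identical, independent unbiased estimators of
`ΔH/N`"; and §III: "one can replace `e^x` with `(e^{(x − x₀)/N})^N` … The best choice for `x₀` is
`x̄`, the mean of `x`. In this case, the variance in Eq. (var) becomes `e^{δ²/N} − 1`."

Lean reading.  For ONE randomized-Taylor factor `Y = Σ_{n ≤ K} Π_{i<n} xᵢ` with `E xᵢ = m₁`,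
`E xᵢ² = m₂` (the printed `m₁ = ΔH̄/N`, `m₂ = \overline{(ΔH/N)²} = (ΔH̄² + δ²)/N²`) and survival
law `μ{n ≤ K} = 1/n!`, the brace of (4) is `E Y²`: grouping `Y²` by the LARGER index,
`Y² = Σ_{m ≤ K} P_m (P_m + 2 Σ_{n<m} P_n)` (`P_n = Π_{i<n} xᵢ`), and by independence
`E[1_{m ≤ K} P_n P_m] = (1/m!) m₂ⁿ m₁^{m−n}` (`n ≤ m`), so
`E Y² = Σ_m (1/m!) (m₂^m + 2 Σ_{n<m} m₂ⁿ m₁^{m−n})` (`hasSum_integral_bkEst_sq`), whose closed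
form is the printed brace: `(m₁ − m₂) E Y² = (m₁ − m₂) e^{m₂} + 2 m₁ (e^{m₁} − e^{m₂})`
(`integral_bkEst_sq_mul_sub`, division-free), i.e. for `m₁ ≠ m₂`
`E Y² = e^{m₂} + 2(e^{m₁} − e^{m₂}) m₁/(m₁ − m₂)` (`integral_bkEst_sq`), and `Var Y = E Y² − e^{2m₁}`
(`variance_bkEst`).  With the `x̄`-subtraction (`m₁ = 0`): `E Y² = e^{m₂}`, `Var Y = e^{m₂} − 1`
(`integral_bkEst_sq_centred`, `variance_bkEst_centred`).  The `N`-fold product of INDEPENDENT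
factors has `E[(Π_j Y_j)²] = Π_j E Y_j²` (`integral_sq_prod_eq_prod`), which turns the one-factor
identities into (4) (`variance_prod`) and into `e^{δ²/N} − 1` (`variance_prod_centred`).
-/

section SecondMoment

variable {x : ℕ → Ω → ℝ} {K : Ω → ℕ}

/-- Index-dependent factor functions on the restricted family: the survival indicator on the
level and `g i` on the `i`-th estimate. [cite: LinLiuSloan2000, §I eq. (4) (the mixed moments
behind the variance)] -/
noncomputable def factorFun₂ (m : ℕ) (g : ℕ → ℝ → ℝ) : Option (Fin m) → ℝ → ℝ :=
  fun j => j.elim (fun r => if (m : ℝ) ≤ r then 1 else 0) (fun i => g i)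

omit [MeasurableSpace Ω] in
/-- The product of the index-dependent factors is `1_{m ≤ K} · Π_{i<m} g_i(xᵢ)`.
[cite: LinLiuSloan2000, §I eq. (4)] -/
theorem prod_factorFun₂_familyFin (m : ℕ) (g : ℕ → ℝ → ℝ) (ω : Ω) :
    ∏ j, factorFun₂ m g j (familyFin x K m j ω) =
      (if m ≤ K ω then 1 else 0) * ∏ i ∈ Finset.range m, g i (x i ω) := by
  rw [Fintype.prod_option]
  congr 1
  · simp [factorFun₂, familyFin, family]
  · simp only [factorFun₂, familyFin, family, Option.map_some, Option.elim_some]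
    exact Fin.prod_univ_eq_prod_range (fun i => g i (x i ω)) m

/-- **Mixed moments by independence**: `E[1_{m≤K} Π_{i<m} g_i(xᵢ)] = μ{m ≤ K} · Π_{i<m} E[g_i(xᵢ)]`
for any measurable `g_i`. [cite: LinLiuSloan2000, §I eq. (4) ("One can also calculate its
variance")] -/
theorem integral_indicator_mul_prod₂ (hind : iIndepFun (family x K) μ) (hKm : Measurable K)
    (hxm : ∀ i, Measurable (x i)) (m : ℕ) {g : ℕ → ℝ → ℝ} (hg : ∀ i, Measurable (g i)) :
    ∫ ω, (if m ≤ K ω then (1 : ℝ) else 0) * ∏ i ∈ Finset.range m, g i (x i ω) ∂μ =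
      μ.real {ω | m ≤ K ω} * ∏ i ∈ Finset.range m, ∫ ω, g i (x i ω) ∂μ := by
  have hW : iIndepFun (familyFin x K m) μ := iIndepFun_familyFin hind m
  have hWm : ∀ j, AEMeasurable (familyFin x K m j) μ := by
    intro j
    cases j with
    | none => exact (measurable_level_real hKm).aemeasurable
    | some i => exact (hxm i.val).aemeasurable
  have hf : ∀ j, AEStronglyMeasurable (factorFun₂ m g j) (μ.map (familyFin x K m j)) := by
    intro j
    cases j with
    | none => exact (measurable_indicatorFun m).aestronglyMeasurable
    | some i => exact (hg i).aestronglyMeasurable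
  have h := hW.integral_fun_prod_comp hWm hf
  simp_rw [prod_factorFun₂_familyFin] at h
  rw [h, Fintype.prod_option]
  congr 1
  · simp only [factorFun₂, familyFin, family, Option.map_none, Option.elim_none]
    exact integral_indicator_level hKm m
  · simp only [factorFun₂, familyFin, family, Option.map_some, Option.elim_some]
    exact Fin.prod_univ_eq_prod_range (fun i => ∫ ω, g i (x i ω) ∂μ) m

/-- Such mixed products are integrable when every `g_i(xᵢ)` is.
[cite: LinLiuSloan2000, §I eq. (4)] -/
theorem integrable_indicator_mul_prod₂ (hind : iIndepFun (family x K) μ) (hKm : Measurable K)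
    (hxm : ∀ i, Measurable (x i)) (m : ℕ) {g : ℕ → ℝ → ℝ} (hg : ∀ i, Measurable (g i))
    (hgi : ∀ i, Integrable (fun ω => g i (x i ω)) μ) :
    Integrable (fun ω => (if m ≤ K ω then (1 : ℝ) else 0) * ∏ i ∈ Finset.range m, g i (x i ω))
      μ := by
  have := hind.isProbabilityMeasure
  have hW : iIndepFun (familyFin x K m) μ := iIndepFun_familyFin hind m
  have hfm : ∀ j, Measurable (factorFun₂ m g j) := by
    intro j
    cases j with
    | none => exact measurable_indicatorFun m
    | some i => exact hg i
  have hY : iIndepFun (fun j => factorFun₂ m g j ∘ familyFin x K m j) μ := hW.comp _ hfm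
  have hYm : ∀ j, Measurable (factorFun₂ m g j ∘ familyFin x K m j) := by
    intro j
    cases j with
    | none => exact (measurable_indicatorFun m).comp (measurable_level_real hKm)
    | some i => exact (hg i).comp (hxm i.val)
  have hYi : ∀ j, Integrable (factorFun₂ m g j ∘ familyFin x K m j) μ := by
    intro j
    cases j with
    | none =>
      refine Integrable.of_bound (C := 1) (hYm none).aestronglyMeasurable (ae_of_all _ fun ω => ?_)
      simp only [Function.comp_apply, factorFun₂, Option.elim_none, Real.norm_eq_abs]
      split_ifs <;> simp
    | some i => exact hgi i.val
  have h := integrable_finset_prod_of_iIndepFun hY hYm hYi Finset.univ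
  refine h.congr (ae_of_all _ fun ω => ?_)
  have := prod_factorFun₂_familyFin (x := x) (K := K) m g ω
  simp only [Function.comp_apply] at this ⊢
  rw [this]

/-- The mixed factor functions of the cross term `T_n T_m`, `n ≤ m`: square below `n`, identity
from `n` on. [cite: LinLiuSloan2000, §I eq. (4)] -/
def mixFun (n : ℕ) : ℕ → ℝ → ℝ := fun i r => if i < n then r ^ 2 else r

/-- `mixFun n i` is measurable. [cite: LinLiuSloan2000, §I eq. (4)] -/
theorem measurable_mixFun (n i : ℕ) : Measurable (mixFun n i) := by
  unfold mixFun
  split_ifs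
  · exact measurable_id.pow_const 2
  · exact measurable_id

omit [MeasurableSpace Ω] in
/-- **The cross term**: for `n ≤ m`, `T_n T_m = 1_{m ≤ K} Π_{i<n} xᵢ² Π_{n≤i<m} xᵢ`
(`1_{n≤K} 1_{m≤K} = 1_{m≤K}`). [cite: LinLiuSloan2000, §I eq. (4)] -/
theorem bkTerm_mul_bkTerm {n m : ℕ} (hnm : n ≤ m) (ω : Ω) :
    bkTerm x K n ω * bkTerm x K m ω =
      (if m ≤ K ω then (1 : ℝ) else 0) * ∏ i ∈ Finset.range m, mixFun n i (x i ω) := by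
  unfold bkTerm
  have hP : ∏ i ∈ Finset.range n, x i ω =
      ∏ i ∈ Finset.range m, (if i < n then x i ω else 1) := by
    rw [Finset.prod_ite, Finset.prod_const_one, mul_one]
    congr 1
    ext i
    simp only [Finset.mem_filter, Finset.mem_range]
    omega
  have hmix : (∏ i ∈ Finset.range n, x i ω) * ∏ i ∈ Finset.range m, x i ω =
      ∏ i ∈ Finset.range m, mixFun n i (x i ω) := by
    rw [hP, ← Finset.prod_mul_distrib]
    refine Finset.prod_congr rfl fun i _ => ?_
    unfold mixFun
    split_ifs <;> ring
  by_cases hm : m ≤ K ω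
  · rw [if_pos hm, if_pos (hnm.trans hm), one_mul, one_mul, one_mul, hmix]
  · rw [if_neg hm]
    ring

/-- `Π_{i<m} (if i < n then a else b) = aⁿ b^{m−n}` for `n ≤ m`. [cite: LinLiuSloan2000, §I
eq. (4) (the powers of `ΔH̄/N` and of `(ΔH̄²+δ²)/N²`)] -/
theorem prod_range_ite_lt {n m : ℕ} (hnm : n ≤ m) (a b : ℝ) :
    ∏ i ∈ Finset.range m, (if i < n then a else b) = a ^ n * b ^ (m - n) := by
  rw [Finset.prod_ite, Finset.prod_const, Finset.prod_const]
  have h1 : (Finset.filter (fun i => i < n) (Finset.range m)).card = n := by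
    have : Finset.filter (fun i => i < n) (Finset.range m) = Finset.range n := by
      ext i; simp only [Finset.mem_filter, Finset.mem_range]; omega
    rw [this, Finset.card_range]
  have h2 : (Finset.filter (fun i => ¬ i < n) (Finset.range m)).card = m - n := by
    have : Finset.filter (fun i => ¬ i < n) (Finset.range m) = Finset.Ico n m := by
      ext i; simp only [Finset.mem_filter, Finset.mem_range, Finset.mem_Ico]; omega
    rw [this, Nat.card_Ico]
  rw [h1, h2]

/-- **Mean of the cross term**: for `n ≤ m`, `E[T_n T_m] = μ{m ≤ K} · m₂ⁿ m₁^{m−n}` when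
`E xᵢ = m₁`, `E xᵢ² = m₂`. [cite: LinLiuSloan2000, §I eq. (4)] -/
theorem integral_bkTerm_mul (hind : iIndepFun (family x K) μ) (hKm : Measurable K)
    (hxm : ∀ i, Measurable (x i)) {m₁ m₂ : ℝ} (hm₁ : ∀ i, ∫ ω, x i ω ∂μ = m₁)
    (hm₂ : ∀ i, ∫ ω, x i ω ^ 2 ∂μ = m₂) {n m : ℕ} (hnm : n ≤ m) :
    ∫ ω, bkTerm x K n ω * bkTerm x K m ω ∂μ = μ.real {ω | m ≤ K ω} * (m₂ ^ n * m₁ ^ (m - n)) := by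
  simp_rw [bkTerm_mul_bkTerm hnm]
  rw [integral_indicator_mul_prod₂ hind hKm hxm m (measurable_mixFun n)]
  congr 1
  rw [← prod_range_ite_lt hnm]
  refine Finset.prod_congr rfl fun i _ => ?_
  unfold mixFun
  split_ifs
  · exact hm₂ i
  · exact hm₁ i

/-- **Absolute moment of the cross term**: for `n ≤ m`, `E|T_n T_m| ≤ μ{m ≤ K} · b₂ⁿ b₁^{m−n}` when
`E xᵢ² ≤ b₂`, `E|xᵢ| ≤ b₁`. [cite: LinLiuSloan2000, §I eq. (4)] -/
theorem integral_abs_bkTerm_mul_le (hind : iIndepFun (family x K) μ) (hKm : Measurable K)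
    (hxm : ∀ i, Measurable (x i)) {b₁ b₂ : ℝ} (hb₁ : ∀ i, ∫ ω, |x i ω| ∂μ ≤ b₁)
    (hb₂ : ∀ i, ∫ ω, x i ω ^ 2 ∂μ ≤ b₂) {n m : ℕ} (hnm : n ≤ m) :
    ∫ ω, |bkTerm x K n ω * bkTerm x K m ω| ∂μ ≤ μ.real {ω | m ≤ K ω} * (b₂ ^ n * b₁ ^ (m - n)) := by
  have e : ∀ ω, |bkTerm x K n ω * bkTerm x K m ω| =
      (if m ≤ K ω then (1 : ℝ) else 0) * ∏ i ∈ Finset.range m, |mixFun n i (x i ω)| := by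
    intro ω
    rw [bkTerm_mul_bkTerm hnm, abs_mul, Finset.abs_prod]
    congr 1
    split_ifs <;> simp
  simp_rw [e]
  have hg : ∀ i, Measurable (fun r : ℝ => |mixFun n i r|) := fun i => (measurable_mixFun n i).abs
  rw [integral_indicator_mul_prod₂ hind hKm hxm m hg]
  refine mul_le_mul_of_nonneg_left ?_ measureReal_nonneg
  rw [← prod_range_ite_lt hnm]
  refine Finset.prod_le_prod (fun i _ => integral_nonneg fun ω => abs_nonneg _) fun i _ => ?_
  unfold mixFun
  split_ifs
  · simp only [abs_pow, sq_abs]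
    exact hb₂ i
  · exact hb₁ i

/-- The cross terms are integrable when `xᵢ ∈ L²`. [cite: LinLiuSloan2000, §I eq. (4)] -/
theorem integrable_bkTerm_mul (hind : iIndepFun (family x K) μ) (hKm : Measurable K)
    (hxm : ∀ i, Measurable (x i)) (hx2 : ∀ i, MemLp (x i) 2 μ) {n m : ℕ} (hnm : n ≤ m) :
    Integrable (fun ω => bkTerm x K n ω * bkTerm x K m ω) μ := by
  have := hind.isProbabilityMeasure
  simp_rw [bkTerm_mul_bkTerm hnm]
  refine integrable_indicator_mul_prod₂ hind hKm hxm m (measurable_mixFun n) fun i => ?_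
  unfold mixFun
  split_ifs
  · exact (hx2 i).integrable_sq
  · exact (hx2 i).integrable one_le_two

/-- The `m`-th block of `Y²` grouped by the larger index: `B_m = T_m (T_m + 2 Σ_{n<m} T_n)`.
[cite: LinLiuSloan2000, §I eq. (4)] -/
def sqBlock (x : ℕ → Ω → ℝ) (K : Ω → ℕ) (m : ℕ) (ω : Ω) : ℝ :=
  bkTerm x K m ω * (bkTerm x K m ω + 2 * ∑ n ∈ Finset.range m, bkTerm x K n ω)

omit [MeasurableSpace Ω] in
/-- Blocks beyond the level vanish. [cite: LinLiuSloan2000, §I eq. (4)] -/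
theorem sqBlock_eq_zero_of_lt {m : ℕ} {ω : Ω} (h : K ω < m) : sqBlock x K m ω = 0 := by
  unfold sqBlock bkTerm
  rw [if_neg (by omega)]
  ring

omit [MeasurableSpace Ω] in
/-- The block as a linear combination of cross terms `T_n T_m`, `n ≤ m`.
[cite: LinLiuSloan2000, §I eq. (4)] -/
theorem sqBlock_eq (m : ℕ) : sqBlock x K m = fun ω => bkTerm x K m ω * bkTerm x K m ω +
    2 * ∑ n ∈ Finset.range m, bkTerm x K n ω * bkTerm x K m ω := by
  funext ω
  simp only [sqBlock, Finset.mul_sum, mul_add]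
  congr 1
  refine Finset.sum_congr rfl fun n _ => ?_
  ring

omit [MeasurableSpace Ω] in
/-- `(Σ_{m<k} T_m)² = Σ_{m<k} B_m` (telescoping: `(S + t)² = S² + t(t + 2S)`).
[cite: LinLiuSloan2000, §I eq. (4)] -/
theorem sum_bkTerm_sq (k : ℕ) (ω : Ω) :
    (∑ m ∈ Finset.range k, bkTerm x K m ω) ^ 2 = ∑ m ∈ Finset.range k, sqBlock x K m ω := by
  induction k with
  | zero => simp
  | succ k IH =>
    rw [Finset.sum_range_succ, Finset.sum_range_succ, ← IH, sqBlock]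
    ring

omit [MeasurableSpace Ω] in
/-- `Y = Σ_{m ≤ K} T_m` (the indicator is `1` there). [cite: LinLiuSloan2000, §I eq. (3)] -/
theorem bkEst_eq_sum_bkTerm (ω : Ω) :
    bkEst x K ω = ∑ m ∈ Finset.range (K ω + 1), bkTerm x K m ω := by
  unfold bkEst bkTerm
  refine Finset.sum_congr rfl fun n hn => ?_
  rw [Finset.mem_range] at hn
  rw [if_pos (by omega), one_mul]

omit [MeasurableSpace Ω] in
/-- **`Y² = Σ_m B_m`** as a finite sum up to the level. [cite: LinLiuSloan2000, §I eq. (4)] -/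
theorem bkEst_sq_eq_sum (ω : Ω) :
    bkEst x K ω ^ 2 = ∑ m ∈ Finset.range (K ω + 1), sqBlock x K m ω := by
  rw [bkEst_eq_sum_bkTerm, sum_bkTerm_sq]

omit [MeasurableSpace Ω] in
/-- **`Y² = Σ_m B_m`** (a pointwise finite series). [cite: LinLiuSloan2000, §I eq. (4)] -/
theorem bkEst_sq_eq_tsum (ω : Ω) : bkEst x K ω ^ 2 = ∑' m, sqBlock x K m ω := by
  have h : ∀ m ∉ Finset.range (K ω + 1), sqBlock x K m ω = 0 := by
    intro m hm
    rw [Finset.mem_range, not_lt] at hm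
    exact sqBlock_eq_zero_of_lt (by omega)
  rw [tsum_eq_sum h, bkEst_sq_eq_sum]

/-- The blocks are integrable. [cite: LinLiuSloan2000, §I eq. (4)] -/
theorem integrable_sqBlock (hind : iIndepFun (family x K) μ) (hKm : Measurable K)
    (hxm : ∀ i, Measurable (x i)) (hx2 : ∀ i, MemLp (x i) 2 μ) (m : ℕ) :
    Integrable (sqBlock x K m) μ := by
  rw [sqBlock_eq]
  refine (integrable_bkTerm_mul hind hKm hxm hx2 le_rfl).add (Integrable.const_mul ?_ 2)
  refine integrable_finsetSum _ fun n hn => ?_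
  exact integrable_bkTerm_mul hind hKm hxm hx2 (Finset.mem_range.mp hn).le

/-- **Mean of a block**: `E B_m = (1/m!) (m₂^m + 2 Σ_{n<m} m₂ⁿ m₁^{m−n})`.
[cite: LinLiuSloan2000, §I eq. (4)] -/
theorem integral_sqBlock (hind : iIndepFun (family x K) μ) (hKm : Measurable K)
    (hxm : ∀ i, Measurable (x i)) (hx2 : ∀ i, MemLp (x i) 2 μ) {m₁ m₂ : ℝ}
    (hm₁ : ∀ i, ∫ ω, x i ω ∂μ = m₁) (hm₂ : ∀ i, ∫ ω, x i ω ^ 2 ∂μ = m₂)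
    (hK : ∀ n : ℕ, μ.real {ω | n ≤ K ω} = 1 / (n ! : ℝ)) (m : ℕ) :
    ∫ ω, sqBlock x K m ω ∂μ =
      1 / (m ! : ℝ) * (m₂ ^ m + 2 * ∑ n ∈ Finset.range m, m₂ ^ n * m₁ ^ (m - n)) := by
  have hI : ∀ n ≤ m, Integrable (fun ω => bkTerm x K n ω * bkTerm x K m ω) μ :=
    fun n hn => integrable_bkTerm_mul hind hKm hxm hx2 hn
  have hIs : Integrable (fun ω => ∑ n ∈ Finset.range m, bkTerm x K n ω * bkTerm x K m ω) μ :=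
    integrable_finsetSum _ fun n hn => hI n (Finset.mem_range.mp hn).le
  rw [sqBlock_eq, integral_add (hI m le_rfl) (hIs.const_mul 2), integral_const_mul,
    integral_finsetSum _ (fun n hn => hI n (Finset.mem_range.mp hn).le),
    integral_bkTerm_mul hind hKm hxm hm₁ hm₂ le_rfl, hK m]
  rw [Finset.sum_congr rfl fun n hn =>
    integral_bkTerm_mul hind hKm hxm hm₁ hm₂ (Finset.mem_range.mp hn).le, hK m,
    ← Finset.mul_sum, Nat.sub_self, pow_zero, mul_one]
  ring

/-- **Absolute mean of a block**: `E|B_m| ≤ (2m + 1) B^m/m!` with `B = max(b₁, b₂)`.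
[cite: LinLiuSloan2000, §I eq. (4) ("It can be shown that only a finite number of terms are
needed in actual calculations")] -/
theorem integral_norm_sqBlock_le (hind : iIndepFun (family x K) μ) (hKm : Measurable K)
    (hxm : ∀ i, Measurable (x i)) (hx2 : ∀ i, MemLp (x i) 2 μ) {b₁ b₂ : ℝ}
    (hb₁ : ∀ i, ∫ ω, |x i ω| ∂μ ≤ b₁) (hb₂ : ∀ i, ∫ ω, x i ω ^ 2 ∂μ ≤ b₂)
    (hK : ∀ n : ℕ, μ.real {ω | n ≤ K ω} = 1 / (n ! : ℝ)) (m : ℕ) :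
    ∫ ω, ‖sqBlock x K m ω‖ ∂μ ≤ (2 * m + 1) * max b₁ b₂ ^ m / m ! := by
  set B := max b₁ b₂ with hB
  have hb₁0 : 0 ≤ b₁ := le_trans (integral_nonneg fun ω => abs_nonneg _) (hb₁ 0)
  have hb₂0 : 0 ≤ b₂ := le_trans (integral_nonneg fun ω => sq_nonneg _) (hb₂ 0)
  have hpow : ∀ n ≤ m, b₂ ^ n * b₁ ^ (m - n) ≤ B ^ m := by
    intro n hn
    calc b₂ ^ n * b₁ ^ (m - n) ≤ B ^ n * B ^ (m - n) :=
          mul_le_mul (pow_le_pow_left₀ hb₂0 (le_max_right _ _) n)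
            (pow_le_pow_left₀ hb₁0 (le_max_left _ _) _) (by positivity) (by positivity)
      _ = B ^ m := by rw [← pow_add, Nat.add_sub_cancel' hn]
  have hcross : ∀ n ≤ m, ∫ ω, |bkTerm x K n ω * bkTerm x K m ω| ∂μ ≤ B ^ m / m ! := by
    intro n hn
    calc ∫ ω, |bkTerm x K n ω * bkTerm x K m ω| ∂μ
        ≤ μ.real {ω | m ≤ K ω} * (b₂ ^ n * b₁ ^ (m - n)) :=
          integral_abs_bkTerm_mul_le hind hKm hxm hb₁ hb₂ hn
      _ ≤ 1 / (m ! : ℝ) * B ^ m := by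
          rw [hK m]
          exact mul_le_mul_of_nonneg_left (hpow n hn) (by positivity)
      _ = B ^ m / m ! := by ring
  have hI : ∀ n ≤ m, Integrable (fun ω => bkTerm x K n ω * bkTerm x K m ω) μ :=
    fun n hn => integrable_bkTerm_mul hind hKm hxm hx2 hn
  have hIs : Integrable (fun ω => ∑ n ∈ Finset.range m, |bkTerm x K n ω * bkTerm x K m ω|) μ :=
    integrable_finsetSum _ fun n hn => (hI n (Finset.mem_range.mp hn).le).abs
  -- pointwise triangle inequality, then integrate
  have hpt : ∀ ω, ‖sqBlock x K m ω‖ ≤ |bkTerm x K m ω * bkTerm x K m ω| +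
      2 * ∑ n ∈ Finset.range m, |bkTerm x K n ω * bkTerm x K m ω| := by
    intro ω
    rw [Real.norm_eq_abs, sqBlock_eq]
    refine (abs_add_le _ _).trans (add_le_add le_rfl ?_)
    rw [abs_mul, abs_two]
    exact mul_le_mul_of_nonneg_left (Finset.abs_sum_le_sum_abs _ _) zero_le_two
  calc ∫ ω, ‖sqBlock x K m ω‖ ∂μ
      ≤ ∫ ω, (|bkTerm x K m ω * bkTerm x K m ω| +
          2 * ∑ n ∈ Finset.range m, |bkTerm x K n ω * bkTerm x K m ω|) ∂μ :=
        integral_mono (integrable_sqBlock hind hKm hxm hx2 m).norm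
          ((hI m le_rfl).abs.add (hIs.const_mul 2)) hpt
    _ = ∫ ω, |bkTerm x K m ω * bkTerm x K m ω| ∂μ +
          2 * ∑ n ∈ Finset.range m, ∫ ω, |bkTerm x K n ω * bkTerm x K m ω| ∂μ := by
        rw [integral_add (hI m le_rfl).abs (hIs.const_mul 2), integral_const_mul,
          integral_finsetSum _ fun n hn => (hI n (Finset.mem_range.mp hn).le).abs]
    _ ≤ B ^ m / m ! + 2 * ∑ _n ∈ Finset.range m, B ^ m / m ! := by
        gcongr with n hn
        · exact hcross m le_rfl
        · exact hcross n (Finset.mem_range.mp hn).le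
    _ = (2 * m + 1) * B ^ m / m ! := by
        rw [Finset.sum_const, Finset.card_range, nsmul_eq_mul]
        ring

/-- `Σ_m (2m + 1) B^m/m!` converges. [cite: LinLiuSloan2000, §I eq. (4)] -/
theorem summable_linear_mul_pow_div_factorial (B : ℝ) :
    Summable fun m : ℕ => (2 * m + 1) * B ^ m / m ! := by
  have h1 : Summable fun m : ℕ => B ^ m / m ! := Real.summable_pow_div_factorial B
  have h2 : Summable fun m : ℕ => (m : ℝ) * (B ^ m / m !) := by
    refine (summable_nat_add_iff 1).mp ?_
    refine ((Real.summable_pow_div_factorial B).mul_left B).congr fun m => ?_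
    rw [Nat.factorial_succ]
    push_cast
    have : ((m : ℝ) + 1) ≠ 0 := by positivity
    have hf : ((m ! : ℕ) : ℝ) ≠ 0 := by positivity
    field_simp
    ring
  refine ((h2.mul_left 2).add h1).congr fun m => ?_
  ring

/-- `E|xᵢ| ≤ √m₂` when `E xᵢ² = m₂` (Cauchy–Schwarz on a probability space).
[cite: LinLiuSloan2000, §I eq. (4) (`δ² = \overline{ΔH²} − ΔH̄² ≥ 0`)] -/
theorem integral_abs_le_sqrt [IsProbabilityMeasure μ] {X : Ω → ℝ} (hX : MemLp X 2 μ) {m₂ : ℝ}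
    (h2 : ∫ ω, X ω ^ 2 ∂μ = m₂) : ∫ ω, |X ω| ∂μ ≤ Real.sqrt m₂ := by
  have hv := variance_nonneg (fun ω => |X ω|) μ
  have hmem : MemLp (fun ω => |X ω|) 2 μ := hX.abs
  rw [variance_eq_sub hmem] at hv
  simp only [Pi.pow_apply, sq_abs, h2] at hv
  have h0 : 0 ≤ ∫ ω, |X ω| ∂μ := integral_nonneg fun ω => abs_nonneg _
  calc ∫ ω, |X ω| ∂μ = Real.sqrt ((∫ ω, |X ω| ∂μ) ^ 2) := (Real.sqrt_sq h0).symm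
    _ ≤ Real.sqrt m₂ := Real.sqrt_le_sqrt (by linarith)

/-- **THE SECOND MOMENT OF THE BHANOT–KENNEDY ESTIMATOR (series form)**: with `E xᵢ = m₁`,
`E xᵢ² = m₂` and survival law `1/n!`, `Y²` is integrable and
`E Y² = Σ_m (1/m!) (m₂^m + 2 Σ_{n<m} m₂ⁿ m₁^{m−n})`.
[cite: LinLiuSloan2000, §I eq. (4) (the brace, before summation in closed form)] -/
theorem hasSum_integral_bkEst_sq (hind : iIndepFun (family x K) μ) (hKm : Measurable K)
    (hxm : ∀ i, Measurable (x i)) (hx2 : ∀ i, MemLp (x i) 2 μ) {m₁ m₂ : ℝ}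
    (hm₁ : ∀ i, ∫ ω, x i ω ∂μ = m₁) (hm₂ : ∀ i, ∫ ω, x i ω ^ 2 ∂μ = m₂)
    (hK : ∀ n : ℕ, μ.real {ω | n ≤ K ω} = 1 / (n ! : ℝ)) :
    Integrable (fun ω => bkEst x K ω ^ 2) μ ∧
      HasSum (fun m => 1 / (m ! : ℝ) * (m₂ ^ m + 2 * ∑ n ∈ Finset.range m, m₂ ^ n * m₁ ^ (m - n)))
        (∫ ω, bkEst x K ω ^ 2 ∂μ) := by
  have := hind.isProbabilityMeasure
  have hb₂ : ∀ i, ∫ ω, x i ω ^ 2 ∂μ ≤ m₂ := fun i => (hm₂ i).le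
  have hb₁ : ∀ i, ∫ ω, |x i ω| ∂μ ≤ Real.sqrt m₂ := fun i => integral_abs_le_sqrt (hx2 i) (hm₂ i)
  have hnorm := integral_norm_sqBlock_le hind hKm hxm hx2 hb₁ hb₂ hK
  have hFi := integrable_sqBlock hind hKm hxm hx2
  have hsum : Summable fun m => ∫ ω, ‖sqBlock x K m ω‖ ∂μ :=
    Summable.of_nonneg_of_le (fun m => integral_nonneg fun ω => norm_nonneg _) hnorm
      (summable_linear_mul_pow_div_factorial _)
  have hmain := hasSum_integral_of_summable_integral_norm hFi hsum
  have e : (fun ω => ∑' m, sqBlock x K m ω) = fun ω => bkEst x K ω ^ 2 :=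
    funext fun ω => (bkEst_sq_eq_tsum ω).symm
  rw [e] at hmain
  simp_rw [integral_sqBlock hind hKm hxm hx2 hm₁ hm₂ hK] at hmain
  refine ⟨⟨?_, ?_⟩, hmain⟩
  · have hY : Integrable (bkEst x K) μ :=
      (integral_bkEst hind hKm hxm (fun i => (hx2 i).integrable one_le_two) hm₁ hb₁ hK).1
    exact hY.aestronglyMeasurable.pow 2
  · -- finite integral: `∫⁻ ‖Y²‖ₑ ≤ Σ_m ∫⁻ ‖B_m‖ₑ = Σ_m E‖B_m‖ < ∞`
    have hpt : ∀ ω, ‖bkEst x K ω ^ 2‖ₑ ≤ ∑' m, ‖sqBlock x K m ω‖ₑ := by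
      intro ω
      rw [bkEst_sq_eq_sum]
      exact (enorm_sum_le _ _).trans (ENNReal.sum_le_tsum _)
    unfold HasFiniteIntegral
    calc ∫⁻ ω, ‖bkEst x K ω ^ 2‖ₑ ∂μ ≤ ∫⁻ ω, ∑' m, ‖sqBlock x K m ω‖ₑ ∂μ := lintegral_mono hpt
      _ = ∑' m, ∫⁻ ω, ‖sqBlock x K m ω‖ₑ ∂μ :=
          lintegral_tsum fun m => (hFi m).aestronglyMeasurable.enorm
      _ = ∑' m, ENNReal.ofReal (∫ ω, ‖sqBlock x K m ω‖ ∂μ) := by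
          refine tsum_congr fun m => ?_
          rw [ofReal_integral_norm_eq_lintegral_enorm (hFi m)]
      _ = ENNReal.ofReal (∑' m, ∫ ω, ‖sqBlock x K m ω‖ ∂μ) :=
          (ENNReal.ofReal_tsum_of_nonneg (fun m => integral_nonneg fun ω => norm_nonneg _) hsum).symm
      _ < ⊤ := ENNReal.ofReal_lt_top

/-- The inner sums in closed form: `(m₁ − m₂) Σ_{n<m} m₂ⁿ m₁^{m−n} = m₁ (m₁^m − m₂^m)` (a geometric
sum). [cite: LinLiuSloan2000, §I eq. (4) (the factor `(ΔH̄/N)/(ΔH̄/N − (ΔH̄²+δ²)/N²)`)] -/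
theorem sub_mul_sum_cross (m₁ m₂ : ℝ) (m : ℕ) :
    (m₁ - m₂) * ∑ n ∈ Finset.range m, m₂ ^ n * m₁ ^ (m - n) = m₁ * (m₁ ^ m - m₂ ^ m) := by
  have h : ∑ n ∈ Finset.range m, m₂ ^ n * m₁ ^ (m - n) =
      m₁ * ∑ n ∈ Finset.range m, m₂ ^ n * m₁ ^ (m - 1 - n) := by
    rw [Finset.mul_sum]
    refine Finset.sum_congr rfl fun n hn => ?_
    rw [Finset.mem_range] at hn
    rw [show m - n = m - 1 - n + 1 by omega, pow_succ]
    ring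
  rw [h]
  have hg := geom_sum₂_mul m₂ m₁ m
  calc (m₁ - m₂) * (m₁ * ∑ n ∈ Finset.range m, m₂ ^ n * m₁ ^ (m - 1 - n))
      = -(m₁ * ((∑ n ∈ Finset.range m, m₂ ^ n * m₁ ^ (m - 1 - n)) * (m₂ - m₁))) := by ring
    _ = m₁ * (m₁ ^ m - m₂ ^ m) := by rw [hg]; ring

/-- **THE SECOND MOMENT IN CLOSED FORM (division-free)**:
`(m₁ − m₂) E Y² = (m₁ − m₂) e^{m₂} + 2 m₁ (e^{m₁} − e^{m₂})`.
[cite: LinLiuSloan2000, §I eq. (4) (the brace)] -/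
theorem integral_bkEst_sq_mul_sub (hind : iIndepFun (family x K) μ) (hKm : Measurable K)
    (hxm : ∀ i, Measurable (x i)) (hx2 : ∀ i, MemLp (x i) 2 μ) {m₁ m₂ : ℝ}
    (hm₁ : ∀ i, ∫ ω, x i ω ∂μ = m₁) (hm₂ : ∀ i, ∫ ω, x i ω ^ 2 ∂μ = m₂)
    (hK : ∀ n : ℕ, μ.real {ω | n ≤ K ω} = 1 / (n ! : ℝ)) :
    (m₁ - m₂) * ∫ ω, bkEst x K ω ^ 2 ∂μ =
      (m₁ - m₂) * Real.exp m₂ + 2 * m₁ * (Real.exp m₁ - Real.exp m₂) := by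
  obtain ⟨_, hS⟩ := hasSum_integral_bkEst_sq hind hKm hxm hx2 hm₁ hm₂ hK
  have hS' := hS.mul_left (m₁ - m₂)
  have he : ∀ a : ℝ, HasSum (fun m : ℕ => a ^ m / m !) (Real.exp a) := fun a => by
    rw [Real.exp_eq_exp_ℝ]
    exact NormedSpace.expSeries_div_hasSum_exp a
  have hT : HasSum (fun m : ℕ => (m₁ - m₂) * (m₂ ^ m / (m ! : ℝ)) +
      2 * m₁ * (m₁ ^ m / (m ! : ℝ) - m₂ ^ m / (m ! : ℝ)))
      ((m₁ - m₂) * Real.exp m₂ + 2 * m₁ * (Real.exp m₁ - Real.exp m₂)) :=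
    ((he m₂).mul_left _).add (((he m₁).sub (he m₂)).mul_left _)
  refine (hS'.unique ?_)
  refine hT.congr_fun fun m => ?_
  have hf : ((m ! : ℕ) : ℝ) ≠ 0 := by positivity
  have key := sub_mul_sum_cross m₁ m₂ m
  field_simp
  linear_combination (2 : ℝ) * key

/-- **LIN–LIU–SLOAN eq. (4), one factor**: for `m₁ ≠ m₂`,
`E Y² = e^{m₂} + 2 (e^{m₁} − e^{m₂}) m₁/(m₁ − m₂)` — the brace of (4) with `m₁ = ΔH̄/N`,
`m₂ = (ΔH̄² + δ²)/N²`. [cite: LinLiuSloan2000, §I eq. (4)] -/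
theorem integral_bkEst_sq (hind : iIndepFun (family x K) μ) (hKm : Measurable K)
    (hxm : ∀ i, Measurable (x i)) (hx2 : ∀ i, MemLp (x i) 2 μ) {m₁ m₂ : ℝ}
    (hm₁ : ∀ i, ∫ ω, x i ω ∂μ = m₁) (hm₂ : ∀ i, ∫ ω, x i ω ^ 2 ∂μ = m₂)
    (hK : ∀ n : ℕ, μ.real {ω | n ≤ K ω} = 1 / (n ! : ℝ)) (hne : m₁ ≠ m₂) :
    ∫ ω, bkEst x K ω ^ 2 ∂μ =
      Real.exp m₂ + 2 * (Real.exp m₁ - Real.exp m₂) * (m₁ / (m₁ - m₂)) := by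
  have h := integral_bkEst_sq_mul_sub hind hKm hxm hx2 hm₁ hm₂ hK
  have hne' : m₁ - m₂ ≠ 0 := sub_ne_zero.mpr hne
  field_simp
  linear_combination h

/-- **The variance of one factor**: `Var Y = E Y² − e^{2m₁}`. [cite: LinLiuSloan2000, §I eq. (4)
(`− e^{2ΔH̄}` for `N = 1`)] -/
theorem variance_bkEst (hind : iIndepFun (family x K) μ) (hKm : Measurable K)
    (hxm : ∀ i, Measurable (x i)) (hx2 : ∀ i, MemLp (x i) 2 μ) {m₁ m₂ : ℝ}
    (hm₁ : ∀ i, ∫ ω, x i ω ∂μ = m₁) (hm₂ : ∀ i, ∫ ω, x i ω ^ 2 ∂μ = m₂)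
    (hK : ∀ n : ℕ, μ.real {ω | n ≤ K ω} = 1 / (n ! : ℝ)) :
    variance (bkEst x K) μ = ∫ ω, bkEst x K ω ^ 2 ∂μ - Real.exp (2 * m₁) := by
  have := hind.isProbabilityMeasure
  have hb₁ : ∀ i, ∫ ω, |x i ω| ∂μ ≤ Real.sqrt m₂ := fun i => integral_abs_le_sqrt (hx2 i) (hm₂ i)
  obtain ⟨hY, hEY⟩ := integral_bkEst hind hKm hxm (fun i => (hx2 i).integrable one_le_two) hm₁ hb₁ hK
  obtain ⟨hY2, _⟩ := hasSum_integral_bkEst_sq hind hKm hxm hx2 hm₁ hm₂ hK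
  have hmem : MemLp (bkEst x K) 2 μ := (memLp_two_iff_integrable_sq hY.aestronglyMeasurable).mpr hY2
  rw [variance_eq_sub hmem]
  simp only [Pi.pow_apply]
  rw [hEY, ← Real.exp_nat_mul]
  norm_num

/-- **The `x̄`-subtracted factor** (`m₁ = 0`): `E Y² = e^{m₂}`. [cite: LinLiuSloan2000, §III
("The best choice for `x₀` is `x̄` … the variance … becomes `e^{δ²/N} − 1`")] -/
theorem integral_bkEst_sq_centred (hind : iIndepFun (family x K) μ) (hKm : Measurable K)
    (hxm : ∀ i, Measurable (x i)) (hx2 : ∀ i, MemLp (x i) 2 μ) {m₂ : ℝ}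
    (hm₁ : ∀ i, ∫ ω, x i ω ∂μ = 0) (hm₂ : ∀ i, ∫ ω, x i ω ^ 2 ∂μ = m₂)
    (hK : ∀ n : ℕ, μ.real {ω | n ≤ K ω} = 1 / (n ! : ℝ)) :
    ∫ ω, bkEst x K ω ^ 2 ∂μ = Real.exp m₂ := by
  obtain ⟨_, hS⟩ := hasSum_integral_bkEst_sq hind hKm hxm hx2 hm₁ hm₂ hK
  have he : HasSum (fun m : ℕ => m₂ ^ m / m !) (Real.exp m₂) := by
    rw [Real.exp_eq_exp_ℝ]
    exact NormedSpace.expSeries_div_hasSum_exp m₂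
  refine hS.unique (he.congr_fun fun m => ?_)
  have h0 : ∑ n ∈ Finset.range m, m₂ ^ n * (0 : ℝ) ^ (m - n) = 0 := by
    refine Finset.sum_eq_zero fun n hn => ?_
    rw [Finset.mem_range] at hn
    rw [zero_pow (by omega), mul_zero]
  rw [h0]
  ring

/-- … hence `Var Y = e^{m₂} − 1` for the centred factor. [cite: LinLiuSloan2000, §III
("becomes `e^{δ²/N} − 1`", `N = 1`)] -/
theorem variance_bkEst_centred (hind : iIndepFun (family x K) μ) (hKm : Measurable K)
    (hxm : ∀ i, Measurable (x i)) (hx2 : ∀ i, MemLp (x i) 2 μ) {m₂ : ℝ}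
    (hm₁ : ∀ i, ∫ ω, x i ω ∂μ = 0) (hm₂ : ∀ i, ∫ ω, x i ω ^ 2 ∂μ = m₂)
    (hK : ∀ n : ℕ, μ.real {ω | n ≤ K ω} = 1 / (n ! : ℝ)) :
    variance (bkEst x K) μ = Real.exp m₂ - 1 := by
  rw [variance_bkEst hind hKm hxm hx2 hm₁ hm₂ hK, integral_bkEst_sq_centred hind hKm hxm hx2 hm₁ hm₂ hK]
  simp

end SecondMoment

/-! ## The `N`-fold product of independent factors -/

section Product

variable {N : ℕ} {Y : Fin N → Ω → ℝ}

/-- `E[Π_j Y_j] = Π_j E Y_j` for independent factors ("`⟨e^{ΔH}⟩ ≡ Π_{i=1}^N e^{x_i}`" with the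
`e^{x_i}` estimated independently). [cite: LinLiuSloan2000, §I eq. (3)] -/
theorem integral_prod_eq_prod (hind : iIndepFun Y μ) (hm : ∀ j, Measurable (Y j)) :
    ∫ ω, ∏ j, Y j ω ∂μ = ∏ j, ∫ ω, Y j ω ∂μ :=
  hind.integral_fun_prod_eq_prod_integral fun j => (hm j).aestronglyMeasurable

/-- `E[(Π_j Y_j)²] = Π_j E Y_j²` for independent factors. [cite: LinLiuSloan2000, §I eq. (4)
(the power `{…}^N`)] -/
theorem integral_sq_prod_eq_prod (hind : iIndepFun Y μ) (hm : ∀ j, Measurable (Y j)) :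
    ∫ ω, (∏ j, Y j ω) ^ 2 ∂μ = ∏ j, ∫ ω, Y j ω ^ 2 ∂μ := by
  have hind' : iIndepFun (fun j => (fun r : ℝ => r ^ 2) ∘ Y j) μ :=
    hind.comp (fun _ r => r ^ 2) fun _ => measurable_id.pow_const 2
  have h := hind'.integral_fun_prod_eq_prod_integral
    fun j => ((hm j).pow_const 2).aestronglyMeasurable
  simp only [Function.comp_def] at h
  rw [← h]
  refine integral_congr_ae (ae_of_all _ fun ω => ?_)
  simp [Finset.prod_pow]

/-- **LIN–LIU–SLOAN eq. (4), the product**: if the `N` factors are independent with `E Y_j = e^{m₁}`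
and `E Y_j² = s` (the one-factor brace), then `Var(Π_j Y_j) = s^N − e^{2 N m₁}` (`= {…}^N − e^{2ΔH̄}`
with `m₁ = ΔH̄/N`). [cite: LinLiuSloan2000, §I eq. (4)] -/
theorem variance_prod (hind : iIndepFun Y μ) (hm : ∀ j, Measurable (Y j))
    (h2 : ∀ j, MemLp (Y j) 2 μ) {m₁ s : ℝ} (hE : ∀ j, ∫ ω, Y j ω ∂μ = Real.exp m₁)
    (hE2 : ∀ j, ∫ ω, Y j ω ^ 2 ∂μ = s) :
    variance (fun ω => ∏ j, Y j ω) μ = s ^ N - Real.exp (2 * N * m₁) := by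
  have := hind.isProbabilityMeasure
  -- the product is square-integrable: `(Π Y_j)²` is a product of independent integrable `Y_j²`
  have hind' : iIndepFun (fun j => (fun r : ℝ => r ^ 2) ∘ Y j) μ :=
    hind.comp (fun _ r => r ^ 2) fun _ => measurable_id.pow_const 2
  have hi2 : Integrable (fun ω => ∏ j ∈ Finset.univ, ((fun r : ℝ => r ^ 2) ∘ Y j) ω) μ :=
    integrable_finset_prod_of_iIndepFun hind' (fun j => (hm j).pow_const 2)
      (fun j => (h2 j).integrable_sq) Finset.univ
  have hmeas : AEStronglyMeasurable (fun ω => ∏ j, Y j ω) μ :=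
    (Finset.aestronglyMeasurable_fun_prod Finset.univ fun j _ => (hm j).aestronglyMeasurable)
  have hmem : MemLp (fun ω => ∏ j, Y j ω) 2 μ := by
    rw [memLp_two_iff_integrable_sq hmeas]
    refine hi2.congr (ae_of_all _ fun ω => ?_)
    simp [Finset.prod_pow]
  rw [variance_eq_sub hmem]
  simp only [Pi.pow_apply]
  rw [integral_sq_prod_eq_prod hind hm, integral_prod_eq_prod hind hm]
  simp only [hE2, hE, Finset.prod_const, Finset.card_univ, Fintype.card_fin]
  rw [← Real.exp_nat_mul, ← Real.exp_nat_mul]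
  ring_nf

/-- **The centred product**: with `s = e^{m₂}` per factor and `m₂ = δ²/N²` (`N ≥ 1`),
`s^N − 1 = e^{δ²/N} − 1` — "the variance … becomes `e^{δ²/N} − 1`". [cite: LinLiuSloan2000, §III
(variance after `x̄`-subtraction)] -/
theorem variance_prod_centred (hind : iIndepFun Y μ) (hm : ∀ j, Measurable (Y j))
    (h2 : ∀ j, MemLp (Y j) 2 μ) {δsq : ℝ} (hN : N ≠ 0) (hE : ∀ j, ∫ ω, Y j ω ∂μ = 1)
    (hE2 : ∀ j, ∫ ω, Y j ω ^ 2 ∂μ = Real.exp (δsq / N ^ 2)) :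
    variance (fun ω => ∏ j, Y j ω) μ = Real.exp (δsq / N) - 1 := by
  have h := variance_prod hind hm h2 (m₁ := 0) (by simpa using hE) hE2
  rw [h, ← Real.exp_nat_mul]
  have hN' : (N : ℝ) ≠ 0 := Nat.cast_ne_zero.mpr hN
  congr 1
  · congr 1
    field_simp
  · simp

end Product

end BhanotKennedy

end Literature.Probability.Moments
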